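import Summits.HodgeConjecture.HodgeConjecture.Theorems.LimitExtensionHypersurfaceHodgeFourLowDegreeStrongLines
import Literature.AlgebraicGeometry.Resolution.ProjectiveResolutionProofs
import Literature.AlgebraicGeometry.HodgeTheory.LefschetzOneOneHolds
import Literature.Barriers.HodgeConjecture.DecompositionOfTheDiagonalDegreeFourOfGysinHodgeCompatible

/-!
# Route LimitExtension — `HypersurfaceHodgeFourLowDegree` (item stmt-HodgeConjecture-3003), IX:
# projective Hironaka and Lefschetz `(1,1)` discharged — the item from a Hodge-compatible Gysin formalism and Prop. 9.20

Helper file for the support item `HypersurfaceHodgeFourLowDegree` of route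
`HodgeConjecture/LimitExtension` (`∀ d ≤ 5, ∀ X, IsSmoothHypersurface 4 d X → HodgeConjectureFor 4 X`).
File VIII (`…StrongLines`) left the item CLOSED MODULO the single named fact
`BlochSrinivas1983_hodgeConjectureDegreeFour_of_chowZeroSupported` (Voisin II, Prop. 10.26), and
recorded its leaf set on the tree's trust base as: a Gysin / cycle-class formalism `G` with
Hodge-compatible Gysin morphisms, projective Hironaka, Prop. 9.20 on products, Lefschetz `(1,1)`
(`limitExtension_hypersurfaceHodgeFourLowDegree_of_leaves`).

Two of these leaves are now THEOREMS of the tree: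

* projective Hironaka — `Resolution.Hironaka1964_projective_holds`
  (`Resolution/ProjectiveResolutionProofs`, Kollár's order reduction run inside `ℙⁿ`);
* Lefschetz `(1,1)` in its rational form — `lefschetzOneOne_rational_holds`
  (`HodgeTheory/LefschetzOneOneHolds`, Kodaira–Serre count + exponential sequence / Čech integrality),
  and with it the Hodge conjecture in dimension `≤ 3`, `hodgeClasses_algebraic_of_dim_le_three_holds`.

Hence:

* `limitExtension_hypersurfaceHodgeFourLowDegree_of_gysin_of_cupProduct` — **the item from a
  Gysin / cycle-class formalism `G : GysinFormalism` whose Gysin morphisms are Hodge compatible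
  (`hG`) and Prop. 9.20 on products in degrees `(4, 2 dim Y)` (`hcupA`) ALONE**;
* `limitExtension_hodgeTwoTwo_algebraic_quarticQuinticFourfold_of_gysin_of_cupProduct` — the
  Conte–Murre named fact from the same two inputs;
* (appended, v2) `limitExtension_hypersurfaceHodgeFourLowDegree_of_gysin` — **the item from `(G, hG)`
  ALONE**, Prop. 9.20 on products being no longer needed
  (`Literature/Barriers/HodgeConjecture/DecompositionOfTheDiagonalDegreeFourOfGysinHodgeCompatible`),
  with the Conte–Murre and Zucker named facts from `(G, hG)` alone.

No `sorry`, no definition, no new named fact.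

## References

* [VoisinHodgeII2003] C. Voisin, Hodge Theory and Complex Algebraic Geometry II (CUP 2003),
  Prop. 10.26 and its proof (§10.2.3, p. 306).
* [VoisinHodgeI2002] C. Voisin, Hodge Theory and Complex Algebraic Geometry I (CUP 2002),
  Thm. 11.30, §11.3.2.
* [Kollar2007] J. Kollár, Lectures on Resolution of Singularities (2007), Thm. 3.27.
* [ConteMurre1978] A. Conte, J. P. Murre, Math. Ann. 238 (1978) 79–88 (cite-only).
* [Zucker1977] S. Zucker, Compositio Math. 34 (1977) 199–209 (cite-only).
-/

-- `Summit.HodgeConjecture.HodgeConjecture.Theorems` is the mandated namespace (single-problem summit: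
-- Problem = Summit), which `linter.dupNamespace` flags on every declaration; the lakefile turns the
-- linter off tree-wide (weak option), restated here so stand-alone elaboration is warning-free too.
set_option linter.dupNamespace false

noncomputable section

namespace Summit.HodgeConjecture.HodgeConjecture.Theorems

open CategoryTheory AlgebraicGeometry MonoidalCategory
open Literature.AlgebraicTopology.SingularHomology
open Literature.AlgebraicGeometry.HodgeTheory Literature.AlgebraicGeometry.Motives
  Literature.Barriers.HodgeConjecture Literature.AlgebraicGeometry

/-- **Voisin II, Prop. 10.26 (Bloch–Srinivas) from a Hodge-compatible Gysin / cycle-class formalism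
and Prop. 9.20 on products alone**: the leaves projective Hironaka
(`Resolution.Hironaka1964_projective_holds`), Hodge models (`nonempty_hodgeModel_holds`), Lefschetz
`(1,1)` (`lefschetzOneOne_rational_holds`) and the Hodge conjecture in dimension `≤ 3`
(`hodgeClasses_algebraic_of_dim_le_three_holds`) of
`BlochSrinivas1983_hodgeConjectureDegreeFour_of_chowZeroSupported_of_gysin_of_resolutions` are
theorems of the tree. [cite: VoisinHodgeII2003, Prop. 10.26 and its proof (§10.2.3, p. 306)]
[cite: Kollar2007, Thm. 3.27] [cite: VoisinHodgeI2002, Thm. 11.30] -/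
theorem limitExtension_blochSrinivas_of_gysin_of_cupProduct (G : GysinFormalism)
    (hG : G.IsGysinHodgeCompatible)
    (hcupA : ∀ ⦃n m : ℕ⦄ ⦃X Y : SchemeOver ℂ⦄, IsSmoothProjective n X → IsSmoothProjective m Y →
      ∀ ⦃x : complexBetti (X ⊗ Y) (2 * 2)⦄ ⦃y : complexBetti (X ⊗ Y) (2 * m)⦄,
        x ∈ algebraicClasses (X ⊗ Y) 2 → y ∈ algebraicClasses (X ⊗ Y) m →
          cupProduct (two_mul_add_two_mul 2 m) x y ∈ algebraicClasses (X ⊗ Y) (2 + m)) :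
    BlochSrinivas1983_hodgeConjectureDegreeFour_of_chowZeroSupported :=
  BlochSrinivas1983_hodgeConjectureDegreeFour_of_chowZeroSupported_of_gysin_of_resolutions G hG
    Resolution.Hironaka1964_projective_holds (fun _ _ ↦ nonempty_hodgeModel_holds) hcupA
    lefschetzOneOne_rational_holds hodgeClasses_algebraic_of_dim_le_three_holds

/-- **`HypersurfaceHodgeFourLowDegree` from a Hodge-compatible Gysin / cycle-class formalism and
Prop. 9.20 on products ALONE.** Granted `G : GysinFormalism` with Hodge-compatible Gysin morphisms
(`hG`; a CONSTRUCTION the tree lacks — Poincaré-dual push-forwards exist as `complexGysin`, the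
cycle-class half with Lemma 9.18 does not) and Prop. 9.20 on products `X ⊗ Y` in degrees
`(4, 2 dim Y)` (`hcupA`), the Hodge conjecture holds for every smooth hypersurface fourfold of degree
`d ≤ 5`: Prop. 10.26 from these two inputs (`limitExtension_blochSrinivas_of_gysin_of_cupProduct`)
fed to file VIII's `limitExtension_hypersurfaceHodgeFourLowDegree_of_blochSrinivas_only` (the
`CH₀`-inputs for all `1 ≤ d ≤ 5`, the other codimensions and the Hodge models being theorems).
Compared with `limitExtension_hypersurfaceHodgeFourLowDegree_of_leaves`: Hironaka and Lefschetz
`(1,1)` are no longer hypotheses. [cite: VoisinHodgeII2003, Prop. 10.26 and its proof (§10.2.3, p. 306)]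
[cite: ConteMurre1978] [cite: Zucker1977] -/
theorem limitExtension_hypersurfaceHodgeFourLowDegree_of_gysin_of_cupProduct (G : GysinFormalism)
    (hG : G.IsGysinHodgeCompatible)
    (hcupA : ∀ ⦃n m : ℕ⦄ ⦃X Y : SchemeOver ℂ⦄, IsSmoothProjective n X → IsSmoothProjective m Y →
      ∀ ⦃x : complexBetti (X ⊗ Y) (2 * 2)⦄ ⦃y : complexBetti (X ⊗ Y) (2 * m)⦄,
        x ∈ algebraicClasses (X ⊗ Y) 2 → y ∈ algebraicClasses (X ⊗ Y) m →
          cupProduct (two_mul_add_two_mul 2 m) x y ∈ algebraicClasses (X ⊗ Y) (2 + m)) :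
    Theses.LimitExtension.HypersurfaceHodgeFourLowDegree :=
  limitExtension_hypersurfaceHodgeFourLowDegree_of_blochSrinivas_only
    (limitExtension_blochSrinivas_of_gysin_of_cupProduct G hG hcupA)

/-- **The Conte–Murre named fact from the same two inputs**: every rational `(2,2)`-class on a
smooth quartic or quintic fourfold is algebraic (`hodgeTwoTwo_algebraic_quarticQuinticFourfold`),
granted `G`, `hG` and Prop. 9.20 on products. [cite: ConteMurre1978]
[cite: VoisinHodgeII2003, Prop. 10.26 and the remark following it (§10.2.3)] -/
theorem limitExtension_hodgeTwoTwo_algebraic_quarticQuinticFourfold_of_gysin_of_cupProduct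
    (G : GysinFormalism) (hG : G.IsGysinHodgeCompatible)
    (hcupA : ∀ ⦃n m : ℕ⦄ ⦃X Y : SchemeOver ℂ⦄, IsSmoothProjective n X → IsSmoothProjective m Y →
      ∀ ⦃x : complexBetti (X ⊗ Y) (2 * 2)⦄ ⦃y : complexBetti (X ⊗ Y) (2 * m)⦄,
        x ∈ algebraicClasses (X ⊗ Y) 2 → y ∈ algebraicClasses (X ⊗ Y) m →
          cupProduct (two_mul_add_two_mul 2 m) x y ∈ algebraicClasses (X ⊗ Y) (2 + m)) :
    hodgeTwoTwo_algebraic_quarticQuinticFourfold :=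
  limitExtension_hodgeTwoTwo_algebraic_quarticQuinticFourfold_of_blochSrinivas
    (limitExtension_blochSrinivas_of_gysin_of_cupProduct G hG hcupA)

/-! ### Appended (v2): Prop. 9.20 on products removed — the item from `(G, hG)` ALONE

`Literature/Barriers/HodgeConjecture/DecompositionOfTheDiagonalDegreeFourOfGysinHodgeCompatible` proves
Voisin II, Prop. 10.26 from a Gysin / cycle-class formalism `G` with Hodge-compatible Gysin morphisms
and NOTHING ELSE (`BlochSrinivas1983_hodgeConjectureDegreeFour_of_chowZeroSupported_of_gysinHodgeCompatible`):
the hypothesis `hcupA` (Prop. 9.20 on `X ⊗ X̃'`, "the compatibility of the cycle class map with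
correspondences") of property (ii) is replaced by the THEOREM that pull-backs of rational
`(2,2)`-classes of degree `4` from varieties of dimension `≤ 3` along dominant morphisms are algebraic
(`Literature/AlgebraicGeometry/HodgeTheory/AlgebraicClassesPullbackDimLEThree`: hard Lefschetz on the
resolved threefold, Lefschetz `(1,1)`, and the hyperplane moved on the resolution). Hence the item's
residue on the tree's trust base is EXACTLY the construction of `G` with `hG`. -/

/-- **`HypersurfaceHodgeFourLowDegree` from a Gysin / cycle-class formalism with Hodge-compatible
Gysin morphisms ALONE.** Granted `G : GysinFormalism` (Gysin morphisms + cycle classes on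
`H*(–(ℂ); ℂ)` with Lemma 9.18, Prop. 9.21 (ii) and `cl[V] = ι_* 1` — a construction the tree lacks on
the cycle-class side; the Gysin side is the constructed `complexGysin`) whose Gysin morphisms preserve
rational classes and Hodge bidegrees (`hG`), the Hodge conjecture holds for every smooth hypersurface
fourfold of degree `d ≤ 5`: Prop. 10.26 from `(G, hG)`
(`BlochSrinivas1983_hodgeConjectureDegreeFour_of_chowZeroSupported_of_gysinHodgeCompatible`) fed to
file VIII's `limitExtension_hypersurfaceHodgeFourLowDegree_of_blochSrinivas_only`. Every other
ingredient — the `CH₀`-inputs for `1 ≤ d ≤ 5` (lines, Roitman's strong lines), the decomposition of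
the diagonal, projective Hironaka, Hodge models, Lefschetz `(1,1)`, hard Lefschetz, the other
codimensions — is a theorem of the tree. [cite: VoisinHodgeII2003, Prop. 10.26 and its proof (§10.2.3, p. 306)]
[cite: ConteMurre1978] [cite: Zucker1977] -/
theorem limitExtension_hypersurfaceHodgeFourLowDegree_of_gysin (G : GysinFormalism)
    (hG : G.IsGysinHodgeCompatible) : Theses.LimitExtension.HypersurfaceHodgeFourLowDegree :=
  limitExtension_hypersurfaceHodgeFourLowDegree_of_blochSrinivas_only
    (BlochSrinivas1983_hodgeConjectureDegreeFour_of_chowZeroSupported_of_gysinHodgeCompatible G hG)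

/-- **The Conte–Murre named fact from `(G, hG)` alone**: every rational `(2,2)`-class on a smooth
quartic or quintic fourfold is algebraic (`hodgeTwoTwo_algebraic_quarticQuinticFourfold`).
[cite: ConteMurre1978] [cite: VoisinHodgeII2003, Prop. 10.26 and the remark following it (§10.2.3)] -/
theorem limitExtension_hodgeTwoTwo_algebraic_quarticQuinticFourfold_of_gysin (G : GysinFormalism)
    (hG : G.IsGysinHodgeCompatible) : hodgeTwoTwo_algebraic_quarticQuinticFourfold :=
  limitExtension_hodgeTwoTwo_algebraic_quarticQuinticFourfold_of_blochSrinivas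
    (BlochSrinivas1983_hodgeConjectureDegreeFour_of_chowZeroSupported_of_gysinHodgeCompatible G hG)

/-- **Zucker's named fact from `(G, hG)` alone**: every rational `(2,2)`-class on a smooth cubic
fourfold is algebraic (`hodgeTwoTwo_algebraic_cubicFourfold`) — the `d = 3` slice of the item, read
back through `limitExtension_twoTwo_of_hypersurfaceHodgeFourLowDegree`. [cite: Zucker1977]
[cite: VoisinHodgeII2003, Prop. 10.26 and the remark following it (§10.2.3)] -/
theorem limitExtension_hodgeTwoTwo_algebraic_cubicFourfold_of_gysin (G : GysinFormalism)
    (hG : G.IsGysinHodgeCompatible) : hodgeTwoTwo_algebraic_cubicFourfold :=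
  fun _ hX c hc h22 ↦ limitExtension_twoTwo_of_hypersurfaceHodgeFourLowDegree
    (limitExtension_hypersurfaceHodgeFourLowDegree_of_gysin G hG) (by norm_num) hX c hc h22

end Summit.HodgeConjecture.HodgeConjecture.Theorems

end
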